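import Mathlib
import Summits.NavierStokesRegularity.NavierStokesRegularity.Theorems.FilamentSkeletonRssAreaLawSlavingDatumBarrier

/-!
# Area-law slaving, part 8 — the CORE WINDOW holds for the straight datum: `W_j′` is `(5N/(πθρ³))`-Lipschitz
# (`FilamentSkeletonRss`, child crux `TangentSkeletonNearStraight`, stmt-NavierStokesRegularity-28295, line
# `child_tangent_analytic_strip`; zeroth-order check of the hypothesis `hsup` (uniform supercriticality on a window) of parts 3–6)

The slaving package (parts 3–6) needs the slip to stay supercritical, `w′ ≥ 3/2 + δ′`, on a whole window `|τ − c| ≤ σ₀√Γ` around its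
zero, whereas the datum clause only gives `W_j′(s₀_j) ≥ 3/2 + δ` AT the zero.  For the straight datum the window is automatic with
Γ-free constants: the closed-form slip is
  `W_j(s) = Σ_{k≠j} (γ_k/2π)·n_jk/‖d_jk(s)‖² + (s − s₀_j)/2 + const`,
with `d_jk(s) = d⁰_jk + s·e_jk` AFFINE in `s` (`e_jk = t_j − ⟪t_j,t_k⟫t_k`, `‖e_jk‖ ≤ 1`) and the numerator `n_jk = ⟪t_k × d_jk(s), t_j⟫`
INDEPENDENT of `s` (`⟪t_k × e_jk, t_j⟫ = 0`), so each partner term is `n/Q(s)` with `Q` quadratic, `Q ≥ ρ²`, `|n| ≤ √Q`, whence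
`|(n/Q)″| ≤ 10/ρ³`.  Results:
* `foot_affine`, `partner_numerator_const`, `norm_dir_sq`, `partner_inner_eq` — the algebra above;
* `hasDerivAt_partner`, `partner_deriv_lipschitz` — `(n/‖d⁰+se‖²)′ = −2n⟪d⁰+se, e⟫/‖d⁰+se‖⁴`, and this derivative is `(10/ρ³)`-Lipschitz;
* `datum_slip_hasDerivAt` — `W_j′(s) = 1/2 − Σ_{k≠j}(γ_k/2π)·2n_jk⟪d_jk(s),e_jk⟫/‖d_jk(s)‖⁴`;
* `datum_slip_deriv_lipschitz` — HEADLINE: `|W_j′(s) − W_j′(s′)| ≤ (5N/(πθρ³))·|s − s′|`;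
* `datum_slip_window` — hence `W_j′ ≥ 3/2 + δ/2` on `|s − s₀_j| ≤ δπθρ³/(10N)` whenever `W_j′(s₀_j) ≥ 3/2 + δ`.
Together with part 7 (far barrier) and the datum's own clauses (floor `mw`, `|W′| ≤ Λ`) every slip hypothesis of the slaving package holds
for the straight datum in waist units with Γ-free constants.

HONEST FRAMING: finite-dimensional vector algebra and one-variable calculus about the straight datum of a HYPOTHETICAL filament skeleton
on the NEGATIVE side of a MODEL route (A1G aside); nothing here bears on Navier–Stokes regularity or blow-up, and no registered stub is closed.
`--supports stmt-NavierStokesRegularity-28295`.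
-/

set_option linter.dupNamespace false

noncomputable section

namespace Summit.NavierStokesRegularity.NavierStokesRegularity.Theorems.AreaLawSlaving

open Set Real Finset
open Literature.Analysis.FluidPDE
open scoped InnerProductSpace

/-! ## §1 Algebra of the foot of the perpendicular -/

/-- The foot vector is AFFINE in the parameter: `d(s) = d(0) + s·(t_j − ⟪t_j,t_k⟫t_k)`. [folklore] -/
theorem foot_affine (pj pk tj tk : EuclideanSpace ℝ (Fin 3)) (s : ℝ) :
    (pj + s • tj - pk) - ⟪pj + s • tj - pk, tk⟫_ℝ • tk =
      ((pj - pk) - ⟪pj - pk, tk⟫_ℝ • tk) + s • (tj - ⟪tj, tk⟫_ℝ • tk) := by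
  have h1 : pj + s • tj - pk = (pj - pk) + s • tj := by abel
  rw [h1, inner_add_left, real_inner_smul_left, add_smul, smul_sub, smul_smul]
  abel

/-- The partner numerator does not see the direction `e = t_j − ⟪t_j,t_k⟫t_k`: `⟪t_k × (d⁰ + s e), t_j⟫ = ⟪t_k × d⁰, t_j⟫`. [folklore] -/
theorem partner_numerator_const (d₀ tj tk : EuclideanSpace ℝ (Fin 3)) (s : ℝ) :
    ⟪cross tk (d₀ + s • (tj - ⟪tj, tk⟫_ℝ • tk)), tj⟫_ℝ = ⟪cross tk d₀, tj⟫_ℝ := by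
  have hsub : cross tk (tj - ⟪tj, tk⟫_ℝ • tk) = cross tk tj - cross tk (⟪tj, tk⟫_ℝ • tk) := by
    rw [← crossCLM_apply, map_sub, crossCLM_apply, crossCLM_apply]
  -- `t_k × (r t_k) = 0` and `⟪t_k × t_j, t_j⟫ = 0`, in coordinates (kept inline: no import from the route's theses cone)
  have hself : cross tk (⟪tj, tk⟫_ℝ • tk) = 0 := by
    rw [← crossCLM_apply, map_smul, crossCLM_apply]
    have : cross tk tk = 0 := by simp [cross]
    rw [this, smul_zero]
  have htrip : ⟪cross tk tj, tj⟫_ℝ = 0 := by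
    simp [cross, crossProduct, PiLp.inner_apply, Fin.sum_univ_three]
    ring
  rw [cross_add_smul_right, inner_add_left, real_inner_smul_left, hsub, hself, sub_zero,
    htrip, mul_zero, add_zero]

/-- `‖t_j − ⟪t_j,t_k⟫t_k‖² = 1 − ⟪t_j,t_k⟫²` for unit vectors; in particular `≤ 1`. [folklore] -/
theorem norm_dir_sq {tj tk : EuclideanSpace ℝ (Fin 3)} (htj : ‖tj‖ = 1) (htk : ‖tk‖ = 1) :
    ‖tj - ⟪tj, tk⟫_ℝ • tk‖ ^ 2 = 1 - ⟪tj, tk⟫_ℝ ^ 2 := by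
  rw [norm_sub_sq_real, htj, real_inner_smul_right, norm_smul, htk, mul_one, Real.norm_eq_abs, sq_abs]
  ring

/-- `‖t_j − ⟪t_j,t_k⟫t_k‖ ≤ 1`. [folklore] -/
theorem norm_dir_le_one {tj tk : EuclideanSpace ℝ (Fin 3)} (htj : ‖tj‖ = 1) (htk : ‖tk‖ = 1) :
    ‖tj - ⟪tj, tk⟫_ℝ • tk‖ ≤ 1 := by
  have h := norm_dir_sq htj htk
  have h1 : ‖tj - ⟪tj, tk⟫_ℝ • tk‖ ^ 2 ≤ 1 := by rw [h]; nlinarith [sq_nonneg ⟪tj, tk⟫_ℝ]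
  nlinarith [norm_nonneg (tj - ⟪tj, tk⟫_ℝ • tk)]

/-- The partner inner product as a rational function of `s`:
`⟪‖d(s)‖⁻² • (t_k × d(s)), t_j⟫ = n/‖d⁰ + s e‖²` with `n = ⟪t_k × d⁰, t_j⟫`. [folklore] -/
theorem partner_inner_eq (pj pk tj tk : EuclideanSpace ℝ (Fin 3)) (s : ℝ) :
    ⟪((‖(pj + s • tj - pk) - ⟪pj + s • tj - pk, tk⟫_ℝ • tk‖ ^ 2)⁻¹ •
        cross tk ((pj + s • tj - pk) - ⟪pj + s • tj - pk, tk⟫_ℝ • tk)), tj⟫_ℝ =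
      ⟪cross tk ((pj - pk) - ⟪pj - pk, tk⟫_ℝ • tk), tj⟫_ℝ /
        ‖((pj - pk) - ⟪pj - pk, tk⟫_ℝ • tk) + s • (tj - ⟪tj, tk⟫_ℝ • tk)‖ ^ 2 := by
  rw [foot_affine, real_inner_smul_left, partner_numerator_const]
  ring

/-! ## §2 Calculus of one partner term `n/‖d⁰ + s e‖²` -/

/-- `Q(s) = ‖d⁰ + s e‖²` has derivative `2⟪d⁰ + s e, e⟫`. [folklore] -/
theorem hasDerivAt_normSq_affine (d₀ e : EuclideanSpace ℝ (Fin 3)) (s : ℝ) :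
    HasDerivAt (fun s : ℝ => ‖d₀ + s • e‖ ^ 2) (2 * ⟪d₀ + s • e, e⟫_ℝ) s := by
  have hrep : (fun s : ℝ => ‖d₀ + s • e‖ ^ 2) = fun s => ‖d₀‖ ^ 2 + 2 * ⟪d₀, e⟫_ℝ * s + ‖e‖ ^ 2 * s ^ 2 := by
    funext s
    rw [norm_add_sq_real, real_inner_smul_right, norm_smul, Real.norm_eq_abs, mul_pow, sq_abs]
    ring
  rw [hrep]
  have h1 : HasDerivAt (fun s : ℝ => ‖d₀‖ ^ 2 + 2 * ⟪d₀, e⟫_ℝ * s) (2 * ⟪d₀, e⟫_ℝ * 1) s :=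
    ((hasDerivAt_id' s).const_mul _).const_add _
  have h2 : HasDerivAt (fun s : ℝ => ‖e‖ ^ 2 * s ^ 2) (‖e‖ ^ 2 * ((2:ℕ) * s ^ (2 - 1) * 1)) s :=
    ((hasDerivAt_id' s).fun_pow 2).const_mul _
  refine (h1.add h2).congr_deriv ?_
  rw [inner_add_left, real_inner_smul_left, real_inner_self_eq_norm_sq]
  push_cast
  ring

/-- Derivative of one partner term: `(n/‖d⁰+se‖²)′ = −n·2⟪d⁰+se, e⟫/(‖d⁰+se‖²)²` (where the foot never vanishes). [folklore] -/
theorem hasDerivAt_partner {d₀ e : EuclideanSpace ℝ (Fin 3)} (n : ℝ) {s : ℝ} (hd : d₀ + s • e ≠ 0) :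
    HasDerivAt (fun s : ℝ => n / ‖d₀ + s • e‖ ^ 2)
      (-(n * (2 * ⟪d₀ + s • e, e⟫_ℝ)) / (‖d₀ + s • e‖ ^ 2) ^ 2) s := by
  have hQ := hasDerivAt_normSq_affine d₀ e s
  have hQne : ‖d₀ + s • e‖ ^ 2 ≠ 0 := pow_ne_zero 2 (norm_ne_zero_iff.2 hd)
  have h := (hasDerivAt_const s n).div hQ hQne
  refine h.congr_deriv ?_
  ring

/-- The derivative of a partner term is `(10/ρ³)`-LIPSCHITZ when the foot stays `ρ`-far (`‖d⁰ + s e‖ ≥ ρ > 0` for all `s`),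
`‖e‖ ≤ 1` and `|n| ≤ ‖d⁰ + s e‖` for all `s` (true for `n = ⟪t_k × d(s), t_j⟫`). [folklore] -/
theorem partner_deriv_lipschitz {d₀ e : EuclideanSpace ℝ (Fin 3)} {n ρ : ℝ} (hρ : 0 < ρ)
    (hfar : ∀ s : ℝ, ρ ≤ ‖d₀ + s • e‖) (he : ‖e‖ ≤ 1) (hn : ∀ s : ℝ, |n| ≤ ‖d₀ + s • e‖) (s s' : ℝ) :
    |n * (2 * ⟪d₀ + s • e, e⟫_ℝ) / (‖d₀ + s • e‖ ^ 2) ^ 2 -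
        n * (2 * ⟪d₀ + s' • e, e⟫_ℝ) / (‖d₀ + s' • e‖ ^ 2) ^ 2| ≤ 10 / ρ ^ 3 * |s - s'| := by
  -- ψ(s) = n·2⟪d,e⟫/Q², derivative 2n(‖e‖² Q − 4⟪d,e⟫²)/Q³, bounded by 10/ρ³
  have hdne : ∀ x : ℝ, d₀ + x • e ≠ 0 := fun x h0 => by
    have := hfar x; rw [h0, norm_zero] at this; linarith
  have hψ : ∀ x : ℝ, HasDerivAt (fun x : ℝ => n * (2 * ⟪d₀ + x • e, e⟫_ℝ) / (‖d₀ + x • e‖ ^ 2) ^ 2)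
      ((n * (2 * ‖e‖ ^ 2) * (‖d₀ + x • e‖ ^ 2) ^ 2 -
        n * (2 * ⟪d₀ + x • e, e⟫_ℝ) * (2 * ‖d₀ + x • e‖ ^ 2 * (2 * ⟪d₀ + x • e, e⟫_ℝ))) /
        ((‖d₀ + x • e‖ ^ 2) ^ 2) ^ 2) x := by
    intro x
    have hu : HasDerivAt (fun x : ℝ => n * (2 * ⟪d₀ + x • e, e⟫_ℝ)) (n * (2 * ‖e‖ ^ 2)) x := by
      have hl : HasDerivAt (fun x : ℝ => ⟪d₀ + x • e, e⟫_ℝ) (‖e‖ ^ 2) x := by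
        have hrep : (fun x : ℝ => ⟪d₀ + x • e, e⟫_ℝ) = fun x => ⟪d₀, e⟫_ℝ + ‖e‖ ^ 2 * x := by
          funext x; rw [inner_add_left, real_inner_smul_left, real_inner_self_eq_norm_sq]; ring
        rw [hrep]
        have := ((hasDerivAt_id' x).const_mul (‖e‖ ^ 2)).const_add ⟪d₀, e⟫_ℝ
        simpa using this
      exact (hl.const_mul 2).const_mul n
    have hv : HasDerivAt (fun x : ℝ => (‖d₀ + x • e‖ ^ 2) ^ 2)
        (2 * ‖d₀ + x • e‖ ^ 2 * (2 * ⟪d₀ + x • e, e⟫_ℝ)) x := by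
      have := (hasDerivAt_normSq_affine d₀ e x).fun_pow 2
      exact this.congr_deriv (by ring)
    have hvne : (‖d₀ + x • e‖ ^ 2) ^ 2 ≠ 0 := pow_ne_zero 2 (pow_ne_zero 2 (norm_ne_zero_iff.2 (hdne x)))
    exact hu.div hv hvne
  have hbound : ∀ x : ℝ, ‖deriv (fun x : ℝ => n * (2 * ⟪d₀ + x • e, e⟫_ℝ) / (‖d₀ + x • e‖ ^ 2) ^ 2) x‖ ≤
      10 / ρ ^ 3 := by
    intro x
    rw [(hψ x).deriv, Real.norm_eq_abs]
    set D : ℝ := ‖d₀ + x • e‖ with hD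
    have hDρ : ρ ≤ D := hfar x
    have hDpos : 0 < D := hρ.trans_le hDρ
    have hB : |⟪d₀ + x • e, e⟫_ℝ| ≤ D := by
      have := abs_real_inner_le_norm (d₀ + x • e) e
      calc |⟪d₀ + x • e, e⟫_ℝ| ≤ ‖d₀ + x • e‖ * ‖e‖ := this
        _ ≤ D * 1 := mul_le_mul_of_nonneg_left he (norm_nonneg _)
        _ = D := mul_one D
    have hnD : |n| ≤ D := hn x
    have he2 : ‖e‖ ^ 2 ≤ 1 := by nlinarith [norm_nonneg e]
    -- rewrite the derivative as 2n(‖e‖² D² − 4⟪d,e⟫²)/D⁶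
    have hsimp : (n * (2 * ‖e‖ ^ 2) * (D ^ 2) ^ 2 - n * (2 * ⟪d₀ + x • e, e⟫_ℝ) * (2 * D ^ 2 * (2 * ⟪d₀ + x • e, e⟫_ℝ))) /
        ((D ^ 2) ^ 2) ^ 2 = 2 * n * (‖e‖ ^ 2 * D ^ 2 - 4 * ⟪d₀ + x • e, e⟫_ℝ ^ 2) / D ^ 6 := by
      field_simp
      ring
    rw [hsimp, abs_div, abs_of_pos (pow_pos hDpos 6), div_le_div_iff₀ (pow_pos hDpos 6) (pow_pos hρ 3)]
    -- |2n(‖e‖²D² − 4B²)| ρ³ ≤ 10 D⁶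
    have h1 : |2 * n * (‖e‖ ^ 2 * D ^ 2 - 4 * ⟪d₀ + x • e, e⟫_ℝ ^ 2)| ≤ 2 * D * (5 * D ^ 2) := by
      rw [abs_mul, abs_mul, abs_of_pos (by norm_num : (0:ℝ) < 2)]
      have h2 : |‖e‖ ^ 2 * D ^ 2 - 4 * ⟪d₀ + x • e, e⟫_ℝ ^ 2| ≤ 5 * D ^ 2 := by
        have hsq : ⟪d₀ + x • e, e⟫_ℝ ^ 2 ≤ D ^ 2 := by
          have := sq_abs ⟪d₀ + x • e, e⟫_ℝ; nlinarith [abs_nonneg ⟪d₀ + x • e, e⟫_ℝ]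
        rw [abs_le]; constructor <;> nlinarith [sq_nonneg D, sq_nonneg ‖e‖]
      exact mul_le_mul (by linarith) h2 (abs_nonneg _) (by positivity)
    have h3 : ρ ^ 3 ≤ D ^ 3 := pow_le_pow_left₀ hρ.le hDρ 3
    calc |2 * n * (‖e‖ ^ 2 * D ^ 2 - 4 * ⟪d₀ + x • e, e⟫_ℝ ^ 2)| * ρ ^ 3 ≤ 2 * D * (5 * D ^ 2) * D ^ 3 :=
          mul_le_mul h1 h3 (pow_pos hρ 3).le (by positivity)
      _ = 10 * D ^ 6 := by ring
  have hmvt := Convex.norm_image_sub_le_of_norm_deriv_le (fun x _ => (hψ x).differentiableAt)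
    (fun x _ => hbound x) convex_univ (mem_univ s') (mem_univ s)
  rw [Real.norm_eq_abs, Real.norm_eq_abs] at hmvt
  exact hmvt

/-! ## §3 The datum's slip: derivative and its Lipschitz bound -/

/-- **Derivative of the datum's slip.**  For the closed-form `W_j` of `StraightDatum` (unit directions, `ρ`-separated lines):
`W_j′(s) = 1/2 − Σ_{k≠j} (γ_k/2π)·n_jk·2⟪d_jk(s), e_jk⟫/‖d_jk(s)‖⁴`. [folklore] -/
theorem datum_slip_hasDerivAt {N : ℕ} {ρ α : ℝ} {p t : Fin N → EuclideanSpace ℝ (Fin 3)} {γ : Fin N → ℝ}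
    (hρ : 0 < ρ) (ht : ∀ j, ‖t j‖ = 1)
    (hsep : ∀ j k, j ≠ k → ∀ τ σ : ℝ, ρ ≤ ‖(p j + τ • t j) - (p k + σ • t k)‖)
    (W : Fin N → ℝ → ℝ)
    (hW : ∀ j s, W j s = ⟪(∑ k ∈ Finset.univ.erase j, (γ k / (2 * Real.pi)) •
      ((‖(p j + s • t j - p k) - ⟪p j + s • t j - p k, t k⟫_ℝ • t k‖ ^ 2)⁻¹ •
        cross (t k) ((p j + s • t j - p k) - ⟪p j + s • t j - p k, t k⟫_ℝ • t k))) +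
      (1 / 2 : ℝ) • (p j + s • t j) - α • cross (EuclideanSpace.single 2 1) (p j + s • t j), t j⟫_ℝ)
    (j : Fin N) (s : ℝ) :
    HasDerivAt (W j) (1 / 2 + ∑ k ∈ Finset.univ.erase j, (γ k / (2 * Real.pi)) *
      (-(⟪cross (t k) ((p j - p k) - ⟪p j - p k, t k⟫_ℝ • t k), t j⟫_ℝ *
        (2 * ⟪((p j - p k) - ⟪p j - p k, t k⟫_ℝ • t k) + s • (t j - ⟪t j, t k⟫_ℝ • t k), t j - ⟪t j, t k⟫_ℝ • t k⟫_ℝ)) /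
        (‖((p j - p k) - ⟪p j - p k, t k⟫_ℝ • t k) + s • (t j - ⟪t j, t k⟫_ℝ • t k)‖ ^ 2) ^ 2)) s := by
  -- the representation of W j as a function
  have hrep : W j = fun s => (s - 0) / 2 + ((∑ k ∈ Finset.univ.erase j, (γ k / (2 * Real.pi)) *
      (⟪cross (t k) ((p j - p k) - ⟪p j - p k, t k⟫_ℝ • t k), t j⟫_ℝ /
        ‖((p j - p k) - ⟪p j - p k, t k⟫_ℝ • t k) + s • (t j - ⟪t j, t k⟫_ℝ • t k)‖ ^ 2)) +
      (1 / 2) * ⟪p j + (0:ℝ) • t j, t j⟫_ℝ - α * ⟪cross (EuclideanSpace.single 2 1) (p j + (0:ℝ) • t j), t j⟫_ℝ) := by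
    funext s
    rw [hW j s, datum_slip_decomp _ _ _ _ _ 0 (ht j), sum_inner]
    have hS : ∑ k ∈ Finset.univ.erase j, ⟪(γ k / (2 * Real.pi)) •
        ((‖(p j + s • t j - p k) - ⟪p j + s • t j - p k, t k⟫_ℝ • t k‖ ^ 2)⁻¹ •
          cross (t k) ((p j + s • t j - p k) - ⟪p j + s • t j - p k, t k⟫_ℝ • t k)), t j⟫_ℝ =
        ∑ k ∈ Finset.univ.erase j, (γ k / (2 * Real.pi)) *
          (⟪cross (t k) ((p j - p k) - ⟪p j - p k, t k⟫_ℝ • t k), t j⟫_ℝ /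
            ‖((p j - p k) - ⟪p j - p k, t k⟫_ℝ • t k) + s • (t j - ⟪t j, t k⟫_ℝ • t k)‖ ^ 2) :=
      Finset.sum_congr rfl fun k _ => by rw [real_inner_smul_left, partner_inner_eq]
    rw [hS]
  rw [hrep]
  -- feet never vanish
  have hfoot : ∀ k ∈ Finset.univ.erase j, ∀ x : ℝ,
      ((p j - p k) - ⟪p j - p k, t k⟫_ℝ • t k) + x • (t j - ⟪t j, t k⟫_ℝ • t k) ≠ 0 := by
    intro k hk x h0
    have hkj : j ≠ k := fun h => (Finset.ne_of_mem_erase hk) h.symm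
    have h := hsep j k hkj x (⟪p j + x • t j - p k, t k⟫_ℝ)
    have e1 : (p j + x • t j) - (p k + ⟪p j + x • t j - p k, t k⟫_ℝ • t k) =
        (p j + x • t j - p k) - ⟪p j + x • t j - p k, t k⟫_ℝ • t k := by abel
    rw [e1, foot_affine, h0, norm_zero] at h
    linarith
  have hsum : HasDerivAt (fun s => ∑ k ∈ Finset.univ.erase j, (γ k / (2 * Real.pi)) *
      (⟪cross (t k) ((p j - p k) - ⟪p j - p k, t k⟫_ℝ • t k), t j⟫_ℝ /
        ‖((p j - p k) - ⟪p j - p k, t k⟫_ℝ • t k) + s • (t j - ⟪t j, t k⟫_ℝ • t k)‖ ^ 2))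
      (∑ k ∈ Finset.univ.erase j, (γ k / (2 * Real.pi)) *
      (-(⟪cross (t k) ((p j - p k) - ⟪p j - p k, t k⟫_ℝ • t k), t j⟫_ℝ *
        (2 * ⟪((p j - p k) - ⟪p j - p k, t k⟫_ℝ • t k) + s • (t j - ⟪t j, t k⟫_ℝ • t k), t j - ⟪t j, t k⟫_ℝ • t k⟫_ℝ)) /
        (‖((p j - p k) - ⟪p j - p k, t k⟫_ℝ • t k) + s • (t j - ⟪t j, t k⟫_ℝ • t k)‖ ^ 2) ^ 2)) s := by
    refine HasDerivAt.fun_sum fun k hk => ?_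
    exact (hasDerivAt_partner _ (hfoot k hk s)).const_mul _
  have hlin : HasDerivAt (fun s : ℝ => (s - 0) / 2) (1 / 2) s := by
    have := ((hasDerivAt_id' s).sub_const (0:ℝ)).div_const 2
    simpa using this
  have h := hlin.add (hsum.add_const
    ((1 / 2) * ⟪p j + (0:ℝ) • t j, t j⟫_ℝ - α * ⟪cross (EuclideanSpace.single 2 1) (p j + (0:ℝ) • t j), t j⟫_ℝ))
  refine h.congr_of_eventuallyEq (Filter.Eventually.of_forall fun x => ?_)
  simp only [Pi.add_apply]
  ring

/-- **Lipschitz bound for the datum's slip derivative.**  Under the clauses of `StraightDatum` (unit directions, `ρ`-separation,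
`|γ_k| ≤ θ⁻¹`): `|W_j′(s) − W_j′(s′)| ≤ (5N/(πθρ³))·|s − s′|`. [folklore] -/
theorem datum_slip_deriv_lipschitz {N : ℕ} {ρ θ α : ℝ} {p t : Fin N → EuclideanSpace ℝ (Fin 3)} {γ : Fin N → ℝ}
    (hρ : 0 < ρ) (hθ : 0 < θ) (ht : ∀ j, ‖t j‖ = 1)
    (hsep : ∀ j k, j ≠ k → ∀ τ σ : ℝ, ρ ≤ ‖(p j + τ • t j) - (p k + σ • t k)‖) (hγ : ∀ j, |γ j| ≤ θ⁻¹)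
    (W : Fin N → ℝ → ℝ)
    (hW : ∀ j s, W j s = ⟪(∑ k ∈ Finset.univ.erase j, (γ k / (2 * Real.pi)) •
      ((‖(p j + s • t j - p k) - ⟪p j + s • t j - p k, t k⟫_ℝ • t k‖ ^ 2)⁻¹ •
        cross (t k) ((p j + s • t j - p k) - ⟪p j + s • t j - p k, t k⟫_ℝ • t k))) +
      (1 / 2 : ℝ) • (p j + s • t j) - α • cross (EuclideanSpace.single 2 1) (p j + s • t j), t j⟫_ℝ)
    (j : Fin N) (s s' : ℝ) :
    |deriv (W j) s - deriv (W j) s'| ≤ 5 * N * θ⁻¹ / (Real.pi * ρ ^ 3) * |s - s'| := by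
  rw [(datum_slip_hasDerivAt hρ ht hsep W hW j s).deriv, (datum_slip_hasDerivAt hρ ht hsep W hW j s').deriv]
  rw [add_sub_add_left_eq_sub, ← Finset.sum_sub_distrib]
  refine (Finset.abs_sum_le_sum_abs _ _).trans ?_
  have hterm : ∀ k ∈ Finset.univ.erase j,
      |γ k / (2 * Real.pi) *
          (-(⟪cross (t k) ((p j - p k) - ⟪p j - p k, t k⟫_ℝ • t k), t j⟫_ℝ *
            (2 * ⟪((p j - p k) - ⟪p j - p k, t k⟫_ℝ • t k) + s • (t j - ⟪t j, t k⟫_ℝ • t k), t j - ⟪t j, t k⟫_ℝ • t k⟫_ℝ)) /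
            (‖((p j - p k) - ⟪p j - p k, t k⟫_ℝ • t k) + s • (t j - ⟪t j, t k⟫_ℝ • t k)‖ ^ 2) ^ 2) -
        γ k / (2 * Real.pi) *
          (-(⟪cross (t k) ((p j - p k) - ⟪p j - p k, t k⟫_ℝ • t k), t j⟫_ℝ *
            (2 * ⟪((p j - p k) - ⟪p j - p k, t k⟫_ℝ • t k) + s' • (t j - ⟪t j, t k⟫_ℝ • t k), t j - ⟪t j, t k⟫_ℝ • t k⟫_ℝ)) /
            (‖((p j - p k) - ⟪p j - p k, t k⟫_ℝ • t k) + s' • (t j - ⟪t j, t k⟫_ℝ • t k)‖ ^ 2) ^ 2)| ≤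
        θ⁻¹ / (2 * Real.pi) * (10 / ρ ^ 3 * |s - s'|) := by
    intro k hk
    have hkj : j ≠ k := fun h => (Finset.ne_of_mem_erase hk) h.symm
    set d₀ : EuclideanSpace ℝ (Fin 3) := (p j - p k) - ⟪p j - p k, t k⟫_ℝ • t k with hd₀
    set e : EuclideanSpace ℝ (Fin 3) := t j - ⟪t j, t k⟫_ℝ • t k with he
    set n : ℝ := ⟪cross (t k) d₀, t j⟫_ℝ with hn
    -- geometric inputs
    have hfar : ∀ x : ℝ, ρ ≤ ‖d₀ + x • e‖ := by
      intro x
      have h := hsep j k hkj x (⟪p j + x • t j - p k, t k⟫_ℝ)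
      have e1 : (p j + x • t j) - (p k + ⟪p j + x • t j - p k, t k⟫_ℝ • t k) =
          (p j + x • t j - p k) - ⟪p j + x • t j - p k, t k⟫_ℝ • t k := by abel
      rw [e1, foot_affine] at h
      exact h
    have he1 : ‖e‖ ≤ 1 := norm_dir_le_one (ht j) (ht k)
    have hnle : ∀ x : ℝ, |n| ≤ ‖d₀ + x • e‖ := by
      intro x
      have h1 : n = ⟪cross (t k) (d₀ + x • e), t j⟫_ℝ := by rw [hn, he, partner_numerator_const]
      rw [h1]
      have h2 := abs_real_inner_le_norm (cross (t k) (d₀ + x • e)) (t j)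
      have h3 := Literature.Analysis.FluidPDE.norm_cross_le_norm_mul_norm (t k) (d₀ + x • e)
      rw [ht k, one_mul] at h3
      rw [ht j, mul_one] at h2
      exact h2.trans h3
    have hL := partner_deriv_lipschitz (n := n) hρ hfar he1 hnle s s'
    rw [← mul_sub, abs_mul, abs_div, abs_of_pos (by positivity : (0:ℝ) < 2 * Real.pi)]
    have hγk : |γ k| / (2 * Real.pi) ≤ θ⁻¹ / (2 * Real.pi) := div_le_div_of_nonneg_right (hγ k) (by positivity)
    have hin : |-(n * (2 * ⟪d₀ + s • e, e⟫_ℝ)) / (‖d₀ + s • e‖ ^ 2) ^ 2 -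
        -(n * (2 * ⟪d₀ + s' • e, e⟫_ℝ)) / (‖d₀ + s' • e‖ ^ 2) ^ 2| ≤ 10 / ρ ^ 3 * |s - s'| := by
      rw [neg_div, neg_div, neg_sub_neg, abs_sub_comm]; exact hL
    exact mul_le_mul hγk hin (abs_nonneg _) (by positivity)
  refine (Finset.sum_le_card_nsmul _ _ _ hterm).trans ?_
  rw [Finset.card_erase_of_mem (Finset.mem_univ j), Finset.card_univ, Fintype.card_fin, nsmul_eq_mul]
  have hc : 0 ≤ θ⁻¹ / (2 * Real.pi) * (10 / ρ ^ 3 * |s - s'|) := by positivity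
  have hN : ((N - 1 : ℕ) : ℝ) ≤ N := by exact_mod_cast Nat.sub_le N 1
  calc ((N - 1 : ℕ) : ℝ) * (θ⁻¹ / (2 * Real.pi) * (10 / ρ ^ 3 * |s - s'|))
      ≤ N * (θ⁻¹ / (2 * Real.pi) * (10 / ρ ^ 3 * |s - s'|)) := mul_le_mul_of_nonneg_right hN hc
    _ = 5 * N * θ⁻¹ / (Real.pi * ρ ^ 3) * |s - s'| := by field_simp; ring

/-- **CORE WINDOW FOR THE DATUM.**  If moreover `W_j′(s₀) ≥ 3/2 + δ`, then `W_j′(s) ≥ 3/2 + δ/2` for all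
`|s − s₀| ≤ δ·π·θ·ρ³/(10N)` — the uniform supercriticality window of the slaving package, with a Γ-free radius. [folklore] -/
theorem datum_slip_window {N : ℕ} {ρ θ α δ : ℝ} {p t : Fin N → EuclideanSpace ℝ (Fin 3)} {γ : Fin N → ℝ}
    (hρ : 0 < ρ) (hθ : 0 < θ) (ht : ∀ j, ‖t j‖ = 1)
    (hsep : ∀ j k, j ≠ k → ∀ τ σ : ℝ, ρ ≤ ‖(p j + τ • t j) - (p k + σ • t k)‖) (hγ : ∀ j, |γ j| ≤ θ⁻¹)
    (W : Fin N → ℝ → ℝ)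
    (hW : ∀ j s, W j s = ⟪(∑ k ∈ Finset.univ.erase j, (γ k / (2 * Real.pi)) •
      ((‖(p j + s • t j - p k) - ⟪p j + s • t j - p k, t k⟫_ℝ • t k‖ ^ 2)⁻¹ •
        cross (t k) ((p j + s • t j - p k) - ⟪p j + s • t j - p k, t k⟫_ℝ • t k))) +
      (1 / 2 : ℝ) • (p j + s • t j) - α • cross (EuclideanSpace.single 2 1) (p j + s • t j), t j⟫_ℝ)
    (j : Fin N) {s₀ : ℝ} (hsup : 3 / 2 + δ ≤ deriv (W j) s₀) {s : ℝ}
    (hs : |s - s₀| ≤ δ * (Real.pi * θ * ρ ^ 3) / (10 * N)) : 3 / 2 + δ / 2 ≤ deriv (W j) s := by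
  have hN : 0 < N := Fin.pos j
  have hNr : (0:ℝ) < N := by exact_mod_cast hN
  have hL := datum_slip_deriv_lipschitz hρ hθ ht hsep hγ W hW j s s₀
  have hM : 0 ≤ 5 * N * θ⁻¹ / (Real.pi * ρ ^ 3) := by positivity
  have h1 : 5 * N * θ⁻¹ / (Real.pi * ρ ^ 3) * |s - s₀| ≤ δ / 2 := by
    calc 5 * N * θ⁻¹ / (Real.pi * ρ ^ 3) * |s - s₀|
        ≤ 5 * N * θ⁻¹ / (Real.pi * ρ ^ 3) * (δ * (Real.pi * θ * ρ ^ 3) / (10 * N)) :=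
          mul_le_mul_of_nonneg_left hs hM
      _ = δ / 2 := by field_simp; ring
  have h2 : deriv (W j) s₀ - deriv (W j) s ≤ δ / 2 := by
    have := neg_abs_le (deriv (W j) s - deriv (W j) s₀)
    linarith [hL.trans h1]
  linarith

end Summit.NavierStokesRegularity.NavierStokesRegularity.Theorems.AreaLawSlaving

end
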